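import Summits.CriticalPhenomena.PercolationContinuityZ3.Theorems.PercNearOneGluingNoHeavyConstsChernoffCount
import HarnessLib

/-!
# The star case of (LT³⁄₂), probability core: `P(#closed relay edges ≥ t) ≤ 3x(1 − x/2)` at the `κ = 2/3` threshold

builds on p205010 (kernel theorem, internal audit signed; external expert review pending)

PAPER-2 track "percolation constants", part (ii), seat `prim-consts-1`, gen 8 (lane index `run/shared/lean/prim/consts/CONSTANTS.md`,
row A19; memo `FROM-prim-consts-1-g8-ROOTED-SPLIT.md` §6b).  Support file for the crux `NoHeavyLowerTail` (stmt-CriticalPhenomena-4575;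
`--supports … --as helper`): theorems only, no definitions, no sorries, standard axioms.  Step (v) and the probability-level assembly of
the plan in `…ConstsChernoffCount` (steps (i)–(iv)).

THE TWO-INTEGER INEQUALITY.  With `u = 3t − K` and `x_t = u/(2K)`, the large-deviation bound of `…ConstsChernoffCount` evaluated at the
largest mean compatible with the `κ = 2/3` threshold is `F(K,t) = (u/(2t))^t (3/2)^{K−t}` (`Consts.chernoff_ld_at_star_threshold`), and
numerically `F(K,t) ≤ 3x_t(1 − x_t/2)` for ALL `K ≥ 5`, `K/3 < t < K` (max ratio `0.740` at `(K,t) = (5,2)`).  This file PROVES it for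
`K ≤ 100` by exact rational arithmetic (`Consts.star_ineq_small`, `interval_cases` + `norm_num`; exactly 3 296 in-range instances `(K,t)`) and for `K > 100`,
`u ≤ 9K/10` analytically (`Consts.star_ineq_tail`): cube, `F³ = (27/8)^K (u/(3t))^{3t}` (`Consts.star_cube_identity`), bound `u/(3t) ≤ q`
on each of five ranges of `u/K` (`[1/5,3/10], [3/10,9/20], [9/20,3/5], [3/5,3/4], [3/4,9/10]`, `Consts.star_piece`) and `u ≤ K/5`
separately (`Consts.star_small_piece`) — every step in natural powers of rationals, no `exp`/`log`.
THE ASSEMBLY.  `Consts.prodBernoulli_real_closedCount_ge_le_star`: for a finite set `F` of `K ≥ 5` coordinates with mean closing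
probability `x = (Σ_{i∈F}(1 − p_i))/K`, `0 < x`, `2x − x² < 2/3`, and `t` the least integer `> K/3 + 2xK/3`:
    `P(t ≤ #{i ∈ F : i closed}) ≤ 3x(1 − x/2) = (3/2)(2x − x²)`
(large-deviation bound at `x`, monotonicity `Consts.ld_ratio_mono` up to `x_t`, the two-integer inequality).  For a STAR with centre `o` and
`K` relay leaves this is `P(1 ≤ N < (2/3)·EN) ≤ (3/2)·(2x − x²) ≤ (3/2)·s` once `s ≥ 2x − x²` (the two largest closing probabilities) —
the remaining graph wrapper (step (vi) of the memo) is bookkeeping.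
References: G. Grimmett, *Percolation* (1999), §2.2; W. Hoeffding, J. Amer. Statist. Assoc. 58 (1963) 13–30.
-/

noncomputable section

namespace Summit.CriticalPhenomena.PercolationContinuityZ3.Theorems

open MeasureTheory Set Literature.Probability.LatticeModels Literature.Probability.Percolation
open scoped Classical

namespace Consts

/-! ### The two-integer inequality for `K ≤ 100`: exact rational arithmetic -/

set_option maxHeartbeats 8000000 in
/-- **`F(K,t) ≤ 3x_t(1 − x_t/2)` for `5 ≤ K ≤ 100` and all `K/3 < t < K`** — exactly 3 296 in-range rational instances
`(K,t)` by `norm_num` (≈ 2 minutes; the out-of-range pairs that `interval_cases` enumerates close from the hypotheses).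
[folklore] -/
theorem star_ineq_small (K t : ℕ) (h5 : 5 ≤ K) (hK : K ≤ 100) (h3 : K + 1 ≤ 3 * t) (htK : t + 1 ≤ K) :
    (((3 * t - K : ℕ) : ℝ) / (2 * t)) ^ t * ((3 : ℝ) / 2) ^ (K - t) ≤
      3 * (((3 * t - K : ℕ) : ℝ) / (2 * K)) * (1 - ((3 * t - K : ℕ) : ℝ) / (4 * K)) := by
  have ht_lo : 2 ≤ t := by omega
  have ht_hi : t ≤ 99 := by omega
  interval_cases K <;> interval_cases t <;> norm_num <;> omega

/-! ### The two-integer inequality for `K > 100`: five pieces in `u/K` and the small-`u` piece -/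

/-- **Cube identity**: `F(K,t)³ = (27/8)^K · ((3t−K)/(3t))^{3t}`. [folklore] -/
theorem star_cube_identity (K t : ℕ) (h3 : K + 1 ≤ 3 * t) (htK : t + 1 ≤ K) :
    ((((3 * t - K : ℕ) : ℝ) / (2 * t)) ^ t * ((3 : ℝ) / 2) ^ (K - t)) ^ 3 =
      ((27 : ℝ) / 8) ^ K * (((3 * t - K : ℕ) : ℝ) / (3 * t)) ^ (3 * t) := by
  have ht : (0 : ℝ) < t := by exact_mod_cast (show 0 < t by omega)
  have hKt : K - t + t = K := Nat.sub_add_cancel (by omega)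
  rw [mul_pow, ← pow_mul, ← pow_mul]
  have e1 : (((3 * t - K : ℕ) : ℝ) / (2 * t)) ^ (t * 3) = ((3 : ℝ) / 2) ^ (3 * t) * (((3 * t - K : ℕ) : ℝ) / (3 * t)) ^ (3 * t) := by
    rw [← mul_pow, mul_comm t 3]
    congr 1
    field_simp
  rw [e1]
  have e2 : ((3 : ℝ) / 2) ^ (3 * t) * (((3 * t - K : ℕ) : ℝ) / (3 * t)) ^ (3 * t) * ((3 : ℝ) / 2) ^ ((K - t) * 3) =
      ((3 : ℝ) / 2) ^ (3 * K) * (((3 * t - K : ℕ) : ℝ) / (3 * t)) ^ (3 * t) := by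
    have : 3 * t + (K - t) * 3 = 3 * K := by omega
    rw [mul_comm (((3 : ℝ) / 2) ^ (3 * t)), mul_assoc, ← pow_add, this, mul_comm]
  rw [e2, pow_mul]; norm_num

/-- **Generic piece** of the analytic tail: on `v₀K ≤ u ≤ v₁K` (`u = 3t−K`, `v₀ = num₀/den₀`, `v₁ = nv₁/dv₁`), with `q ≥ v₁/(1+v₁)`,
`c ≥ (27/8)^{den₀} q^{den₀+num₀}`, `c ≤ 1`, `c^100 ≤ (r³)^{den₀}` and `r ≤` the right-hand side, one gets `F(K,t) ≤` right-hand side for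
`K ≥ 100` (all in natural powers: `(F³)^{den₀} ≤ c^K ≤ c^100`). [folklore] -/
theorem star_piece (K t : ℕ) (hK : 100 ≤ K) (h3 : K + 1 ≤ 3 * t) (htK : t + 1 ≤ K)
    (q c r : ℝ) (num₀ den₀ nv₁ dv₁ : ℕ) (hden : 0 < den₀) (hdv : 0 < dv₁)
    (hq0 : 0 ≤ q) (hq1 : q ≤ 1)
    (hlo : num₀ * K ≤ den₀ * (3 * t - K)) (hhi : dv₁ * (3 * t - K) ≤ nv₁ * K)
    (hqv : (nv₁ : ℝ) ≤ q * (nv₁ + dv₁))            -- v₁/(1+v₁) ≤ q  with v₁ = nv₁/dv₁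
    (hc : ((27 : ℝ) / 8) ^ den₀ * q ^ (den₀ + num₀) ≤ c) (hc0 : 0 ≤ c) (hc1 : c ≤ 1)
    (hcr : c ^ 100 ≤ (r ^ 3) ^ den₀) (hr0 : 0 ≤ r)
    (hrR : r ≤ 3 * (((3 * t - K : ℕ) : ℝ) / (2 * K)) * (1 - ((3 * t - K : ℕ) : ℝ) / (4 * K))) :
    (((3 * t - K : ℕ) : ℝ) / (2 * t)) ^ t * ((3 : ℝ) / 2) ^ (K - t) ≤
      3 * (((3 * t - K : ℕ) : ℝ) / (2 * K)) * (1 - ((3 * t - K : ℕ) : ℝ) / (4 * K)) := by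
  set u : ℕ := 3 * t - K with hu
  set F : ℝ := (((u : ℕ) : ℝ) / (2 * t)) ^ t * ((3 : ℝ) / 2) ^ (K - t) with hF
  have hu3 : 3 * t = K + u := by omega
  have ht0 : (0 : ℝ) < t := by exact_mod_cast (show 0 < t by omega)
  have hK0 : (0 : ℝ) < K := by exact_mod_cast (show 0 < K by omega)
  have hu0 : (0 : ℝ) ≤ u := by exact_mod_cast Nat.zero_le u
  have hF0 : 0 ≤ F := mul_nonneg (pow_nonneg (div_nonneg hu0 (by linarith)) _) (pow_nonneg (by norm_num) _)
  -- F^3 = (27/8)^K (u/(3t))^(3t) = (27/8)^K (u/(K+u))^(K+u)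
  have hcube : F ^ 3 = ((27 : ℝ) / 8) ^ K * (((u : ℕ) : ℝ) / (3 * t)) ^ (3 * t) := star_cube_identity K t h3 htK
  -- u/(3t) ≤ q
  have hratio : ((u : ℕ) : ℝ) / (3 * t) ≤ q := by
    rw [div_le_iff₀ (by linarith)]
    have h1 : ((dv₁ : ℕ) : ℝ) * u ≤ nv₁ * K := by exact_mod_cast hhi
    have h2 : (3 : ℝ) * t = K + u := by exact_mod_cast hu3
    rw [h2]
    -- u (nv₁ + dv₁) ≤ nv₁ (K+u) ≤ q (nv₁+dv₁)(K+u)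
    have hdvR : (0 : ℝ) < dv₁ := by exact_mod_cast hdv
    have hnv : (0 : ℝ) ≤ nv₁ := by exact_mod_cast Nat.zero_le _
    have hsum : (0 : ℝ) < nv₁ + dv₁ := by linarith
    have k1 : ((u : ℕ) : ℝ) * (nv₁ + dv₁) ≤ nv₁ * (K + u) := by nlinarith
    have k2 : (nv₁ : ℝ) * (K + u) ≤ q * (nv₁ + dv₁) * (K + u) :=
      mul_le_mul_of_nonneg_right hqv (by linarith)
    have k3 : ((u : ℕ) : ℝ) * (nv₁ + dv₁) ≤ (q * (K + u)) * (nv₁ + dv₁) := by nlinarith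
    exact le_of_mul_le_mul_right k3 hsum
  have hratio0 : 0 ≤ ((u : ℕ) : ℝ) / (3 * t) := div_nonneg hu0 (by linarith)
  -- (u/3t)^(3t) ≤ q^(K+u) = q^K * q^u
  have hpow1 : (((u : ℕ) : ℝ) / (3 * t)) ^ (3 * t) ≤ q ^ K * q ^ u := by
    rw [hu3, ← pow_add]; exact pow_le_pow_left₀ hratio0 hratio _
  -- (q^u)^den₀ ≤ q^(num₀ K)
  have hpow2 : (q ^ u) ^ den₀ ≤ q ^ (num₀ * K) := by
    rw [← pow_mul]
    exact pow_le_pow_of_le_one hq0 hq1 (le_of_le_of_eq hlo (mul_comm _ _))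
  -- (F^3)^den₀ ≤ c^K
  have hstep : (F ^ 3) ^ den₀ ≤ c ^ K := by
    rw [hcube]
    calc (((27 : ℝ) / 8) ^ K * (((u : ℕ) : ℝ) / (3 * t)) ^ (3 * t)) ^ den₀
        ≤ (((27 : ℝ) / 8) ^ K * (q ^ K * q ^ u)) ^ den₀ :=
          pow_le_pow_left₀ (mul_nonneg (pow_nonneg (by norm_num) _) (pow_nonneg hratio0 _))
            (mul_le_mul_of_nonneg_left hpow1 (pow_nonneg (by norm_num) _)) _
      _ = (((27 : ℝ) / 8) ^ den₀ * q ^ den₀) ^ K * (q ^ u) ^ den₀ := by ring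
      _ ≤ (((27 : ℝ) / 8) ^ den₀ * q ^ den₀) ^ K * q ^ (num₀ * K) :=
          mul_le_mul_of_nonneg_left hpow2 (pow_nonneg (mul_nonneg (pow_nonneg (by norm_num) _) (pow_nonneg hq0 _)) _)
      _ = (((27 : ℝ) / 8) ^ den₀ * q ^ (den₀ + num₀)) ^ K := by ring
      _ ≤ c ^ K := pow_le_pow_left₀ (mul_nonneg (pow_nonneg (by norm_num) _) (pow_nonneg hq0 _)) hc _
  -- c^K ≤ c^100 ≤ (r^3)^den₀
  have hcK : c ^ K ≤ c ^ 100 := pow_le_pow_of_le_one hc0 hc1 hK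
  have hfin : (F ^ 3) ^ den₀ ≤ (r ^ 3) ^ den₀ := hstep.trans (hcK.trans hcr)
  have hF3 : F ^ 3 ≤ r ^ 3 := (pow_le_pow_iff_left₀ (pow_nonneg hF0 3) (pow_nonneg hr0 3) hden.ne').1 hfin
  have hFr : F ≤ r := (pow_le_pow_iff_left₀ hF0 hr0 (by norm_num)).1 hF3
  exact hFr.trans hrR


/-- **Small-`u` piece**: for `K ≥ 100` and `5u ≤ K`, `F³ ≤ (27u/(8K))^K ≤ (3u/(2K))³·27/64 ≤` (right-hand side)³. [folklore] -/
theorem star_small_piece (K t : ℕ) (hK : 100 ≤ K) (h3 : K + 1 ≤ 3 * t) (htK : t + 1 ≤ K) (hsmall : 5 * (3 * t - K) ≤ K) :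
    (((3 * t - K : ℕ) : ℝ) / (2 * t)) ^ t * ((3 : ℝ) / 2) ^ (K - t) ≤
      3 * (((3 * t - K : ℕ) : ℝ) / (2 * K)) * (1 - ((3 * t - K : ℕ) : ℝ) / (4 * K)) := by
  set u : ℕ := 3 * t - K with hu
  set F : ℝ := (((u : ℕ) : ℝ) / (2 * t)) ^ t * ((3 : ℝ) / 2) ^ (K - t) with hF
  have hu3 : 3 * t = K + u := by omega
  have hu1 : 1 ≤ u := by omega
  have ht0 : (0 : ℝ) < t := by exact_mod_cast (show 0 < t by omega)
  have hK0 : (0 : ℝ) < K := by exact_mod_cast (show 0 < K by omega)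
  have hu0 : (0 : ℝ) < u := by exact_mod_cast (show 0 < u by omega)
  have huK : ((u : ℕ) : ℝ) * 5 ≤ K := by exact_mod_cast (by omega : u * 5 ≤ K)
  have hF0 : 0 ≤ F := mul_nonneg (pow_nonneg (div_nonneg hu0.le (by linarith)) _) (pow_nonneg (by norm_num) _)
  have hcube : F ^ 3 = ((27 : ℝ) / 8) ^ K * (((u : ℕ) : ℝ) / (3 * t)) ^ (3 * t) := star_cube_identity K t h3 htK
  set y : ℝ := ((u : ℕ) : ℝ) / K with hy
  have hy0 : 0 ≤ y := div_nonneg hu0.le hK0.le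
  have hy1 : y ≤ 1 := by rw [hy, div_le_one hK0]; linarith
  -- (u/(3t))^(3t) ≤ y^(3t) ≤ y^K
  have hratio : ((u : ℕ) : ℝ) / (3 * t) ≤ y := by
    rw [hy]; exact div_le_div_of_nonneg_left hu0.le hK0 (by rw [show (3 : ℝ) * t = K + u by exact_mod_cast hu3]; linarith)
  have h1 : (((u : ℕ) : ℝ) / (3 * t)) ^ (3 * t) ≤ y ^ K :=
    (pow_le_pow_left₀ (div_nonneg hu0.le (by linarith)) hratio _).trans (pow_le_pow_of_le_one hy0 hy1 (by omega))
  -- F^3 ≤ (27/8)^K y^K = (3y/2)^K (9/4)^K ... ≤ (3y/2)^3 * 27/64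
  have h3y : (3 : ℝ) * y / 2 ≤ 3 / 10 := by
    rw [hy]; rw [div_le_iff₀ (by norm_num : (0:ℝ) < 2)]
    rw [mul_div_assoc']; rw [div_le_iff₀ hK0]; linarith
  have h3y0 : 0 ≤ (3 : ℝ) * y / 2 := by positivity
  have hF3 : F ^ 3 ≤ ((3 : ℝ) * y / 2) ^ 3 * (27 / 64) := by
    rw [hcube]
    obtain ⟨n, hn⟩ : ∃ n, K = n + 3 := ⟨K - 3, by omega⟩
    have hn97 : 97 ≤ n := by omega
    have hprod : (3 : ℝ) * y / 2 * (9 / 4) ≤ 3 / 10 * (9 / 4) := mul_le_mul_of_nonneg_right h3y (by norm_num)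
    have hprod0 : 0 ≤ (3 : ℝ) * y / 2 * (9 / 4) := by positivity
    calc ((27 : ℝ) / 8) ^ K * (((u : ℕ) : ℝ) / (3 * t)) ^ (3 * t) ≤ ((27 : ℝ) / 8) ^ K * y ^ K :=
          mul_le_mul_of_nonneg_left h1 (pow_nonneg (by norm_num) _)
      _ = ((3 : ℝ) * y / 2 * (9 / 4)) ^ (n + 3) := by rw [hn, ← mul_pow]; congr 1; ring
      _ = ((3 : ℝ) * y / 2) ^ 3 * ((9 : ℝ) / 4) ^ 3 * ((3 : ℝ) * y / 2 * (9 / 4)) ^ n := by ring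
      _ ≤ ((3 : ℝ) * y / 2) ^ 3 * ((9 : ℝ) / 4) ^ 3 * ((3 : ℝ) / 10 * (9 / 4)) ^ n :=
          mul_le_mul_of_nonneg_left (pow_le_pow_left₀ hprod0 hprod n) (by positivity)
      _ ≤ ((3 : ℝ) * y / 2) ^ 3 * ((9 : ℝ) / 4) ^ 3 * ((3 : ℝ) / 10 * (9 / 4)) ^ 97 := by
          refine mul_le_mul_of_nonneg_left ?_ (by positivity)
          exact pow_le_pow_of_le_one (by norm_num) (by norm_num) hn97
      _ ≤ ((3 : ℝ) * y / 2) ^ 3 * (27 / 64) := by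
          rw [mul_assoc]
          refine mul_le_mul_of_nonneg_left ?_ (pow_nonneg h3y0 _)
          norm_num
  -- RHS^3 ≥ (3y/2)^3 (19/20)^3 ≥ (3y/2)^3 * 27/64
  set R : ℝ := 3 * (((u : ℕ) : ℝ) / (2 * K)) * (1 - ((u : ℕ) : ℝ) / (4 * K)) with hR
  have hR' : R = ((3 : ℝ) * y / 2) * (1 - y / 4) := by rw [hR, hy]; field_simp
  have hfac : (19 : ℝ) / 20 ≤ 1 - y / 4 := by
    have : y ≤ 1 / 5 := by rw [hy, div_le_iff₀ hK0]; linarith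
    linarith
  have hR0 : 0 ≤ R := by rw [hR']; exact mul_nonneg h3y0 (by linarith)
  have hR3 : ((3 : ℝ) * y / 2) ^ 3 * (27 / 64) ≤ R ^ 3 := by
    rw [hR', mul_pow]
    refine mul_le_mul_of_nonneg_left ?_ (pow_nonneg h3y0 _)
    calc ((27 : ℝ) / 64) ≤ ((19 : ℝ) / 20) ^ 3 := by norm_num
      _ ≤ (1 - y / 4) ^ 3 := pow_le_pow_left₀ (by norm_num) hfac 3
  exact (pow_le_pow_iff_left₀ hF0 hR0 (by norm_num)).1 (hF3.trans hR3)

/-- The right-hand side `3x(1 − x/2)`, `x = u/(2K)`, is at least `3(v₀/2)(1 − v₁/4)` on the piece `v₀K ≤ u ≤ v₁K` (`v₁ ≤ 4`). [folklore] -/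
theorem star_rhs_lower {u K v₀ v₁ : ℝ} (hK0 : 0 < K) (hlo : v₀ * K ≤ u) (hhi : u ≤ v₁ * K) (hv₁ : v₁ ≤ 4) (hv₀ : 0 ≤ v₀) :
    3 * (v₀ / 2) * (1 - v₁ / 4) ≤ 3 * (u / (2 * K)) * (1 - u / (4 * K)) := by
  have hw0 : v₀ ≤ u / K := by rw [le_div_iff₀ hK0]; exact hlo
  have hw1 : u / K ≤ v₁ := by rw [div_le_iff₀ hK0]; exact hhi
  have e : 3 * (u / (2 * K)) * (1 - u / (4 * K)) = 3 * ((u / K) / 2) * (1 - (u / K) / 4) := by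
    field_simp
  rw [e]
  set w := u / K with hw
  nlinarith [mul_nonneg (sub_nonneg.2 hw0) (sub_nonneg.2 hw1), mul_nonneg (sub_nonneg.2 hw0) (sub_nonneg.2 hv₁),
    mul_nonneg hv₀ (sub_nonneg.2 hw1)]

/-- **`F(K,t) ≤ 3x_t(1 − x_t/2)` for `K > 100` and `3t − K ≤ 9K/10`**, assembled from the small-`u` piece and the five pieces
`[1/5,3/10], [3/10,9/20], [9/20,3/5], [3/5,3/4], [3/4,9/10]` (the case `K ≤ 100` is taken as a hypothesis; see `Consts.star_ineq`). [folklore] -/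
theorem star_ineq_tail (K t : ℕ) (h3 : K + 1 ≤ 3 * t) (htK : t + 1 ≤ K) (hrange : 10 * (3 * t - K) ≤ 9 * K)
    (small : K ≤ 100 → (((3 * t - K : ℕ) : ℝ) / (2 * t)) ^ t * ((3 : ℝ) / 2) ^ (K - t) ≤
      3 * (((3 * t - K : ℕ) : ℝ) / (2 * K)) * (1 - ((3 * t - K : ℕ) : ℝ) / (4 * K))) :
    (((3 * t - K : ℕ) : ℝ) / (2 * t)) ^ t * ((3 : ℝ) / 2) ^ (K - t) ≤
      3 * (((3 * t - K : ℕ) : ℝ) / (2 * K)) * (1 - ((3 * t - K : ℕ) : ℝ) / (4 * K)) := by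
  by_cases hK : K ≤ 100
  · exact small hK
  have hK100 : 100 ≤ K := by omega
  set u : ℕ := 3 * t - K with hu
  have hK0 : (0 : ℝ) < K := by exact_mod_cast (show 0 < K by omega)
  by_cases c0 : 5 * u ≤ K
  · exact star_small_piece K t hK100 h3 htK c0
  by_cases c1 : 10 * u ≤ 3 * K
  · have hlo0 : (1 : ℝ) / 5 * K ≤ ((u : ℕ) : ℝ) := by
      have h : ((1 : ℕ) : ℝ) * K ≤ (5 : ℕ) * u := by exact_mod_cast (show 1 * K ≤ 5 * u by omega)
      push_cast at h
      rw [div_mul_eq_mul_div, div_le_iff₀ (by norm_num : (0:ℝ) < 5)]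
      linarith
    have hhi0 : ((u : ℕ) : ℝ) ≤ (3 : ℝ) / 10 * K := by
      have h : ((10 : ℕ) : ℝ) * u ≤ (3 : ℕ) * K := by exact_mod_cast c1
      push_cast at h
      rw [div_mul_eq_mul_div, le_div_iff₀ (by norm_num : (0:ℝ) < 10)]
      linarith
    exact star_piece K t hK100 h3 htK (3 / 13) (((27 : ℝ) / 8) ^ 5 * ((3 / 13 : ℝ)) ^ (5 + 1)) (3 * ((1 : ℝ) / 5 / 2) * (1 - ((3 : ℝ) / 10) / 4)) 1 5 3 10 (by norm_num) (by norm_num) (by norm_num) (by norm_num)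
      (by omega) c1 (by norm_num) le_rfl (by positivity) (by norm_num) (by norm_num) (by norm_num)
      (star_rhs_lower hK0 hlo0 hhi0 (by norm_num) (by norm_num))
  by_cases c2 : 20 * u ≤ 9 * K
  · have hlo1 : (3 : ℝ) / 10 * K ≤ ((u : ℕ) : ℝ) := by
      have h : ((3 : ℕ) : ℝ) * K ≤ (10 : ℕ) * u := by exact_mod_cast (show 3 * K ≤ 10 * u by omega)
      push_cast at h
      rw [div_mul_eq_mul_div, div_le_iff₀ (by norm_num : (0:ℝ) < 10)]
      linarith
    have hhi1 : ((u : ℕ) : ℝ) ≤ (9 : ℝ) / 20 * K := by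
      have h : ((20 : ℕ) : ℝ) * u ≤ (9 : ℕ) * K := by exact_mod_cast c2
      push_cast at h
      rw [div_mul_eq_mul_div, le_div_iff₀ (by norm_num : (0:ℝ) < 20)]
      linarith
    exact star_piece K t hK100 h3 htK (9 / 29) (((27 : ℝ) / 8) ^ 10 * ((9 / 29 : ℝ)) ^ (10 + 3)) (3 * ((3 : ℝ) / 10 / 2) * (1 - ((9 : ℝ) / 20) / 4)) 3 10 9 20 (by norm_num) (by norm_num) (by norm_num) (by norm_num)
      (by omega) c2 (by norm_num) le_rfl (by positivity) (by norm_num) (by norm_num) (by norm_num)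
      (star_rhs_lower hK0 hlo1 hhi1 (by norm_num) (by norm_num))
  by_cases c3 : 5 * u ≤ 3 * K
  · have hlo2 : (9 : ℝ) / 20 * K ≤ ((u : ℕ) : ℝ) := by
      have h : ((9 : ℕ) : ℝ) * K ≤ (20 : ℕ) * u := by exact_mod_cast (show 9 * K ≤ 20 * u by omega)
      push_cast at h
      rw [div_mul_eq_mul_div, div_le_iff₀ (by norm_num : (0:ℝ) < 20)]
      linarith
    have hhi2 : ((u : ℕ) : ℝ) ≤ (3 : ℝ) / 5 * K := by
      have h : ((5 : ℕ) : ℝ) * u ≤ (3 : ℕ) * K := by exact_mod_cast c3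
      push_cast at h
      rw [div_mul_eq_mul_div, le_div_iff₀ (by norm_num : (0:ℝ) < 5)]
      linarith
    exact star_piece K t hK100 h3 htK (3 / 8) (((27 : ℝ) / 8) ^ 20 * ((3 / 8 : ℝ)) ^ (20 + 9)) (3 * ((9 : ℝ) / 20 / 2) * (1 - ((3 : ℝ) / 5) / 4)) 9 20 3 5 (by norm_num) (by norm_num) (by norm_num) (by norm_num)
      (by omega) c3 (by norm_num) le_rfl (by positivity) (by norm_num) (by norm_num) (by norm_num)
      (star_rhs_lower hK0 hlo2 hhi2 (by norm_num) (by norm_num))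
  by_cases c4 : 4 * u ≤ 3 * K
  · have hlo3 : (3 : ℝ) / 5 * K ≤ ((u : ℕ) : ℝ) := by
      have h : ((3 : ℕ) : ℝ) * K ≤ (5 : ℕ) * u := by exact_mod_cast (show 3 * K ≤ 5 * u by omega)
      push_cast at h
      rw [div_mul_eq_mul_div, div_le_iff₀ (by norm_num : (0:ℝ) < 5)]
      linarith
    have hhi3 : ((u : ℕ) : ℝ) ≤ (3 : ℝ) / 4 * K := by
      have h : ((4 : ℕ) : ℝ) * u ≤ (3 : ℕ) * K := by exact_mod_cast c4
      push_cast at h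
      rw [div_mul_eq_mul_div, le_div_iff₀ (by norm_num : (0:ℝ) < 4)]
      linarith
    exact star_piece K t hK100 h3 htK (3 / 7) (((27 : ℝ) / 8) ^ 5 * ((3 / 7 : ℝ)) ^ (5 + 3)) (3 * ((3 : ℝ) / 5 / 2) * (1 - ((3 : ℝ) / 4) / 4)) 3 5 3 4 (by norm_num) (by norm_num) (by norm_num) (by norm_num)
      (by omega) c4 (by norm_num) le_rfl (by positivity) (by norm_num) (by norm_num) (by norm_num)
      (star_rhs_lower hK0 hlo3 hhi3 (by norm_num) (by norm_num))
  have hlo4 : (3 : ℝ) / 4 * K ≤ ((u : ℕ) : ℝ) := by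
    have h : ((3 : ℕ) : ℝ) * K ≤ (4 : ℕ) * u := by exact_mod_cast (show 3 * K ≤ 4 * u by omega)
    push_cast at h
    rw [div_mul_eq_mul_div, div_le_iff₀ (by norm_num : (0:ℝ) < 4)]
    linarith
  have hhi4 : ((u : ℕ) : ℝ) ≤ (9 : ℝ) / 10 * K := by
    have h : ((10 : ℕ) : ℝ) * u ≤ (9 : ℕ) * K := by exact_mod_cast (show 10 * u ≤ 9 * K by omega)
    push_cast at h
    rw [div_mul_eq_mul_div, le_div_iff₀ (by norm_num : (0:ℝ) < 10)]
    linarith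
  exact star_piece K t hK100 h3 htK (9 / 19) (((27 : ℝ) / 8) ^ 4 * ((9 / 19 : ℝ)) ^ (4 + 3)) (3 * ((3 : ℝ) / 4 / 2) * (1 - ((9 : ℝ) / 10) / 4)) 3 4 9 10 (by norm_num) (by norm_num) (by norm_num) (by norm_num)
    (by omega) (by omega) (by norm_num) le_rfl (by positivity) (by norm_num) (by norm_num) (by norm_num)
    (star_rhs_lower hK0 hlo4 hhi4 (by norm_num) (by norm_num))

/-- **The two-integer inequality** (memo §6b step (v)): for all `K ≥ 5`, `K/3 < t < K` with `3t − K ≤ 9K/10`,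
`((3t−K)/(2t))^t (3/2)^{K−t} ≤ 3x_t(1 − x_t/2)`, `x_t = (3t−K)/(2K)`. [folklore] -/
theorem star_ineq (K t : ℕ) (h5 : 5 ≤ K) (h3 : K + 1 ≤ 3 * t) (htK : t + 1 ≤ K) (hrange : 10 * (3 * t - K) ≤ 9 * K) :
    (((3 * t - K : ℕ) : ℝ) / (2 * t)) ^ t * ((3 : ℝ) / 2) ^ (K - t) ≤
      3 * (((3 * t - K : ℕ) : ℝ) / (2 * K)) * (1 - ((3 * t - K : ℕ) : ℝ) / (4 * K)) :=
  star_ineq_tail K t h3 htK hrange fun hK => star_ineq_small K t h5 hK h3 htK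

/-! ### APPEND (gen 8, same seat): the probability-level assembly of the star case -/

variable {ι : Type*} [Finite ι]

/-- **The star case of (LT³⁄₂), probability core.**  `F` a finite set of `K ≥ 5` coordinates, `x` the mean closing probability,
`0 < x`, `2x − x² < 2/3`, and `t` the least integer exceeding `K/3 + 2xK/3`.  Then
`P(t ≤ #{i ∈ F : i closed}) ≤ 3x(1 − x/2) = (3/2)(2x − x²)`. [folklore] -/
theorem prodBernoulli_real_closedCount_ge_le_star (p : ι → unitInterval) (F : Finset ι) (h5 : 5 ≤ F.card)
    {x : ℝ} (hxdef : x = (∑ i ∈ F, (1 - (p i : ℝ))) / F.card) (hx0 : 0 < x) (hx2 : 2 * x - x ^ 2 < 2 / 3)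
    {t : ℕ} (ht1 : (F.card : ℝ) / 3 + 2 * x * F.card / 3 < t) (ht2 : (t : ℝ) ≤ F.card / 3 + 2 * x * F.card / 3 + 1) :
    (prodBernoulli p).real {ω : Set ι | t ≤ (F.filter fun i => i ∉ ω).card} ≤ 3 * x * (1 - x / 2) := by
  set K : ℕ := F.card with hKdef
  have hK0 : (0 : ℝ) < K := by exact_mod_cast (show 0 < K by omega)
  have hK5 : (5 : ℝ) ≤ K := by exact_mod_cast h5
  -- x ≤ 1 (mean of numbers in [0,1]) hence x < 0.4227
  have hx1 : x ≤ 1 := by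
    rw [hxdef, div_le_one hK0]
    calc ∑ i ∈ F, (1 - (p i : ℝ)) ≤ ∑ i ∈ F, (1 : ℝ) := Finset.sum_le_sum fun i _ => by linarith [(p i).2.1]
      _ = K := by simp [hKdef]
  have hxs : x < 4227 / 10000 := by
    by_contra h
    push Not at h
    nlinarith
  have ht3 : K + 1 ≤ 3 * t := by
    have h : (K : ℝ) < 3 * t := by nlinarith
    have h' : (K : ℝ) < ((3 * t : ℕ) : ℝ) := by push_cast; exact h
    exact_mod_cast h'
  have htK : t + 1 ≤ K := by
    by_contra h
    have hKt : (K : ℝ) ≤ t := by exact_mod_cast (show K ≤ t by omega)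
    nlinarith
  have ht2' : 2 ≤ t := by omega
  set m : ℕ := K - t with hm
  have hm1 : 0 < m := by omega
  have hKtm : K = t + m := by omega
  have hmean : x * ((t : ℝ) + m) ≤ t := by
    have : ((t : ℝ) + m) = K := by rw [hKtm]; push_cast; ring
    rw [this]; nlinarith
  have hld := prodBernoulli_real_closedCount_ge_le_ld p F (by omega) hm1 hKtm hxdef hx0 (by linarith) hmean
  set y : ℝ := ((3 * t - K : ℕ) : ℝ) / (2 * K) with hy
  have hcast : ((3 * t - K : ℕ) : ℝ) = 3 * (t : ℝ) - K := by
    rw [Nat.cast_sub (by omega)]; push_cast; ring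
  have hy0 : 0 < y := by rw [hy, hcast]; apply div_pos <;> nlinarith
  have hy1 : y < 1 := by
    rw [hy, hcast, div_lt_one (by linarith)]
    have : (t : ℝ) + 1 ≤ K := by exact_mod_cast htK
    linarith
  have hxy : x ≤ y := by
    rw [hy, hcast, le_div_iff₀ (by linarith)]; linarith
  have hyt : y * (((t - 1 : ℕ) : ℝ) + m) ≤ ((t - 1 : ℕ) : ℝ) := by
    have htc : ((t - 1 : ℕ) : ℝ) = (t : ℝ) - 1 := by rw [Nat.cast_sub (by omega)]; push_cast; ring
    have hmc : (m : ℝ) = K - t := by rw [hm, Nat.cast_sub (by omega)]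
    rw [htc, hmc, hy, hcast, div_mul_eq_mul_div, div_le_iff₀ (by linarith)]
    have hK3 : (3 : ℝ) ≤ K := by linarith
    have htK' : (t : ℝ) ≤ K := by exact_mod_cast (show t ≤ K by omega)
    nlinarith [mul_nonneg (sub_nonneg.2 hK3) (sub_nonneg.2 htK')]
  have hmono := ld_ratio_mono (t := t) (m := m) ht2' hx0 hxy hy1 hyt
  have hF := chernoff_ld_at_star_threshold (t := t) (m := m) (by omega) hm1
  have hstar : (((3 * t - K : ℕ) : ℝ) / (2 * t)) ^ t * ((3 : ℝ) / 2) ^ (K - t) ≤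
      3 * (((3 * t - K : ℕ) : ℝ) / (2 * K)) * (1 - ((3 * t - K : ℕ) : ℝ) / (4 * K)) := by
    by_cases hK100 : K ≤ 100
    · exact star_ineq_small K t h5 hK100 ht3 htK
    · refine star_ineq K t h5 ht3 htK ?_
      -- 10 (3t - K) ≤ 9 K  from  3t - K ≤ 2xK + 3 < 0.8454 K + 3 ≤ 0.9 K  (K > 100)
      have hK100' : (100 : ℝ) < K := by exact_mod_cast (show 100 < K by omega)
      have hr : (10 : ℝ) * ((3 * t - K : ℕ) : ℝ) ≤ 9 * K := by rw [hcast]; nlinarith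
      exact_mod_cast hr
  have hxx : 0 < x * (1 - x / 2) := by nlinarith
  have hyy : 0 < y * (1 - y / 2) := by nlinarith
  have hmono' : x ^ t * (1 - x) ^ m ≤ y ^ t * (1 - y) ^ m * (x * (1 - x / 2)) / (y * (1 - y / 2)) := by
    rw [le_div_iff₀ hyy]
    have := hmono
    rw [div_le_div_iff₀ hxx hyy] at this
    linarith
  have hKR : ((t : ℝ) + m) = K := by rw [hKtm]; push_cast; ring
  have hyK : y = (3 * (t : ℝ) - (t + m)) / (2 * (t + m)) := by rw [hy, hcast, hKR]
  have hC0 : 0 ≤ (((t : ℝ) + m) / t) ^ t * (((t : ℝ) + m) / m) ^ m := by positivity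
  have hFeq : (((t : ℝ) + m) / t) ^ t * (((t : ℝ) + m) / m) ^ m * y ^ t * (1 - y) ^ m =
      (((3 * t - K : ℕ) : ℝ) / (2 * t)) ^ t * ((3 : ℝ) / 2) ^ (K - t) := by
    rw [hyK, hF, hcast, hKR, ← hm]
  have hRHS : 3 * (((3 * t - K : ℕ) : ℝ) / (2 * K)) * (1 - ((3 * t - K : ℕ) : ℝ) / (4 * K)) = 3 * (y * (1 - y / 2)) := by
    rw [hy]; field_simp; ring
  calc (prodBernoulli p).real {ω : Set ι | t ≤ (F.filter fun i => i ∉ ω).card}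
      ≤ (((t : ℝ) + m) / t) ^ t * (((t : ℝ) + m) / m) ^ m * x ^ t * (1 - x) ^ m := hld
    _ = (((t : ℝ) + m) / t) ^ t * (((t : ℝ) + m) / m) ^ m * (x ^ t * (1 - x) ^ m) := by ring
    _ ≤ (((t : ℝ) + m) / t) ^ t * (((t : ℝ) + m) / m) ^ m * (y ^ t * (1 - y) ^ m * (x * (1 - x / 2)) / (y * (1 - y / 2))) :=
        mul_le_mul_of_nonneg_left hmono' hC0
    _ = ((((t : ℝ) + m) / t) ^ t * (((t : ℝ) + m) / m) ^ m * y ^ t * (1 - y) ^ m) * (x * (1 - x / 2)) / (y * (1 - y / 2)) := by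
        ring
    _ ≤ 3 * (y * (1 - y / 2)) * (x * (1 - x / 2)) / (y * (1 - y / 2)) := by
        rw [hFeq]
        refine div_le_div_of_nonneg_right (mul_le_mul_of_nonneg_right ?_ hxx.le) hyy.le
        rw [← hRHS]; exact hstar
    _ = 3 * x * (1 - x / 2) := by
        rw [show 3 * (y * (1 - y / 2)) * (x * (1 - x / 2)) / (y * (1 - y / 2)) =
          (x * (1 - x / 2)) * (3 * (y * (1 - y / 2)) / (y * (1 - y / 2))) by ring, mul_div_cancel_right₀ (3 : ℝ) hyy.ne']
        ring
end Consts

end Summit.CriticalPhenomena.PercolationContinuityZ3.Theorems
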